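import Literature.Analysis.FluidPDE.SpaceTimeCalculus
import Summits.NavierStokesRegularity.NavierStokesRegularity.Theorems.RellichScarSymmetricScarExistsApexScaleInvariantBoundsLemmas

/-!
# Crux `ScarRigidity` (stmt-NavierStokesRegularity-11717), line `moment-conditioned-rellich`:
# stub `stub_apexRegularity` — III: exchange of `∂ₜ` with `Dⁿ`, and the differentiated momentum equation

Helper file (`--supports stmt-NavierStokesRegularity-11717`; theorems only, no definitions, no named
facts) for the registered stub `stub_apexRegularity` of line `moment-conditioned-rellich` (crux `ScarRigidity`,
route RellichScar): a Type-I ancient mild field `V` with the apex bound `‖V(t,x)‖ ≤ C/(‖x‖+√(−t))` is a classical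
Navier–Stokes solution on `(−∞, 0)` with a pressure `Q` obeying the ALL-ORDERS scale-invariant package
`‖∇ⁿV‖ ≤ L/(‖x‖+√(−t))^{1+n}`, `‖∇ⁿQ‖ ≤ L/(‖x‖+√(−t))^{2+n}`, `‖∂ₜ∇ⁿV‖ ≤ L/(‖x‖+√(−t))^{3+n}`; necessarily `Q` is
the Riesz pressure `Q[V(t)] = RᵢRⱼ(VᵢVⱼ)` (the tree's `pressurePotential`).  This file supplies the
space–time calculus at all orders:

* `hasDerivAt_iteratedFDeriv_slice`, `deriv_iteratedFDeriv_slice` — **`∂ₜDⁿ = Dⁿ∂ₜ`** for fields jointly smooth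
  on an open time set (induction on `n` with the tree's operator-valued exchange `hasDerivAt_fderiv_slice_clm`);
  `isSmoothSpaceTimeOn_iteratedDeriv` (all time derivatives are jointly smooth) and the scalar iterated form
  `iteratedFDeriv_iteratedDeriv_apply` (`Dⁿ(∂ₜᵃw)(x) m = ∂ₜᵃ[Dⁿw(·)(x) m]`);
* `norm_iteratedFDeriv_laplacian_le_three_mul_three_mul` (`‖DⁿΔf‖ ≤ 3‖Dⁿ⁺²f‖` on `ℝ³`), `norm_iteratedFDeriv_gradient`,
  `norm_iteratedFDeriv_convect_self_le` (Leibniz);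
* `window_decay_velocity` (on a window `(t₁, t₂) ⋐ (−∞, 0)` all spatial derivatives of a classical Type-I solution
  decay like `(1+|y|)⁻¹`), `tower_props` (the tower `∂ₜᵇw` of a jointly smooth field is jointly smooth and closed
  under `∂ₜ`);
* `norm_iteratedFDeriv_timeDeriv_le`, `weight_pow_mul_norm_iteratedFDeriv_timeDeriv_le` — **the third member of the
  package from the first two**: `Dⁿ∂ₜv = Dⁿ(Δv − ∇q − (v·∇)v)` for a classical solution on the past, so
  `(‖x‖+√(−t))^{n+3}‖Dⁿ∂ₜv‖ ≤ 3K_{n+2} + K_q + Σᵢ C(n,i) K_{i+1}K_{n−i}`.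

## References

* G. Koch, N. Nadirashvili, G. Seregin, V. Šverák, Acta Math. 203 (2009) 83–105 = arXiv:0709.3599, §4 Prop. 4.1,
  §6. [KochNadirashviliSereginSverak2009]
* G. Seregin, V. Šverák, Comm. PDE 34 (2009) = arXiv:0804.1803, §2 p. 8. [SereginSverak2009]
* B. Pineau, V. Vicol, arXiv:2607.09619 (2026), Lemma 2.1, Lemma 7.1. [PineauVicol2026]
* D. Gilbarg, N. S. Trudinger, *Elliptic PDE of Second Order* (2001), Lemma 4.1–4.2. [GilbargTrudinger2001]
-/

noncomputable section

open MeasureTheory Set Function Filter Topology Metric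
open scoped ContDiff Laplacian

-- nested operator types (`ℝ³ →L[ℝ] ℝ³ →L[ℝ] ℝ³ →L[ℝ] ℝ`, `(X →L[ℝ] X [×n]→L[ℝ] F) →L[ℝ] X [×(n+1)]→L[ℝ] F`)
set_option maxSynthPendingDepth 4

namespace Summit.NavierStokesRegularity.NavierStokesRegularity.Theorems.RellichScarScarRigidity

open Literature.Analysis.FluidPDE
open Literature.Analysis.FluidPDE.FourierNS (HasDecay)
open Summit.NavierStokesRegularity.NavierStokesRegularity.Theorems.SymmetricScarExists.LogtimeBernoulli
  (timeDeriv_eq_of_classical)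

/-! ### Exchange of time derivatives and spatial derivatives of all orders -/

section Exchange

variable {X : Type*} [NormedAddCommGroup X] [NormedSpace ℝ X]
variable {F : Type*} [NormedAddCommGroup F] [NormedSpace ℝ F]
variable {S : Set ℝ} {w : ℝ → X → F} {t : ℝ}

/-- If two functions agree near `x`, their iterated derivatives agree at `x`. [folklore] -/
theorem iteratedDeriv_eq_of_eventuallyEq {f g : ℝ → F} {x : ℝ} (h : f =ᶠ[𝓝 x] g) (n : ℕ) :
    iteratedDeriv n f x = iteratedDeriv n g x := by
  rw [iteratedDeriv_eq_iteratedFDeriv, iteratedDeriv_eq_iteratedFDeriv, (h.iteratedFDeriv ℝ n).eq_of_nhds]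

/-- On an open time set, **`∂ₜ Dⁿ = Dⁿ ∂ₜ` for jointly smooth fields, at every order**: the time line
`s ↦ Dⁿ(w s)(x)` has derivative `Dⁿ(∂ₜw(t, ·))(x)` at `t ∈ S` (induction on `n` with the operator-valued
exchange `hasDerivAt_fderiv_slice_clm` of the tree). [folklore] -/
theorem hasDerivAt_iteratedFDeriv_slice (h : IsSmoothSpaceTimeOn S w) (hS : IsOpen S) :
    ∀ (n : ℕ), ∀ t ∈ S, ∀ x : X,
      HasDerivAt (fun s => iteratedFDeriv ℝ n (w s) x)
        (iteratedFDeriv ℝ n (fun y => deriv (fun s => w s y) t) x) t := by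
  intro n
  induction n with
  | zero =>
    intro t ht x
    have h0 := h.hasDerivAt_timeLine hS ht x
    exact ((continuousMultilinearCurryFin0 ℝ X F).symm.toContinuousLinearEquiv :
      F →L[ℝ] (X [×0]→L[ℝ] F)).hasFDerivAt.comp_hasDerivAt t h0
  | succ n ih =>
    intro t ht x
    set W : ℝ → X → (X [×n]→L[ℝ] F) := fun s y => iteratedFDeriv ℝ n (w s) y with hW
    have hWs : IsSmoothSpaceTimeOn S W := h.iteratedFDeriv_slice hS.uniqueDiffOn n
    have h1 : HasDerivAt (fun s => fderiv ℝ (W s) x) (fderiv ℝ (fun y => deriv (fun s => W s y) t) x) t :=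
      hWs.hasDerivAt_fderiv_slice_clm hS ht x
    have h2 : (fun y => deriv (fun s => W s y) t) = iteratedFDeriv ℝ n (fun y => deriv (fun s => w s y) t) := by
      funext y
      exact (ih t ht y).deriv
    rw [h2] at h1
    set L : (X →L[ℝ] (X [×n]→L[ℝ] F)) →L[ℝ] (X [×(n + 1)]→L[ℝ] F) :=
      ↑(continuousMultilinearCurryLeftEquiv ℝ (fun _ : Fin (n + 1) => X) F).symm.toContinuousLinearEquiv
      with hL
    have hLd : HasFDerivAt (⇑L) L (fderiv ℝ (W t) x) := L.hasFDerivAt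
    exact hLd.comp_hasDerivAt t h1

/-- The `deriv` form of the exchange: `∂ₜ[Dⁿ(w ·)(x)](t) = Dⁿ(∂ₜw(t,·))(x)`. [folklore] -/
theorem deriv_iteratedFDeriv_slice (h : IsSmoothSpaceTimeOn S w) (hS : IsOpen S)
    (n : ℕ) (ht : t ∈ S) (x : X) :
    deriv (fun s => iteratedFDeriv ℝ n (w s) x) t = iteratedFDeriv ℝ n (fun y => deriv (fun s => w s y) t) x :=
  (hasDerivAt_iteratedFDeriv_slice h hS n t ht x).deriv

/-- On an open time set, **all time derivatives `(t, x) ↦ ∂ₜᵃ w(t, x)` of a jointly smooth field are jointly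
smooth**. [folklore] -/
theorem isSmoothSpaceTimeOn_iteratedDeriv (h : IsSmoothSpaceTimeOn S w) (hS : IsOpen S) :
    ∀ a : ℕ, IsSmoothSpaceTimeOn S fun t x => iteratedDeriv a (fun s => w s x) t := by
  intro a
  induction a with
  | zero => simpa only [iteratedDeriv_zero] using h
  | succ a ih =>
    have e : (fun t x => iteratedDeriv (a + 1) (fun s => w s x) t) =
        fun t x => deriv (fun s => (fun s' x' => iteratedDeriv a (fun σ => w σ x') s') s x) t := by
      funext t x
      rw [iteratedDeriv_succ]
    rw [e]
    exact ih.isSmoothSpaceTimeOn_deriv hS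

/-- **Exchange of `∂ₜᵃ` and `Dⁿ` (scalar form)**: for a field jointly smooth on an open time set,
`Dⁿ(∂ₜᵃ w(t, ·))(x) m = ∂ₜᵃ[s ↦ Dⁿ(w s)(x) m](t)` for `t ∈ S`. [folklore] -/
theorem iteratedFDeriv_iteratedDeriv_apply (hS : IsOpen S) :
    ∀ (a : ℕ) {w : ℝ → X → F}, IsSmoothSpaceTimeOn S w → ∀ (n : ℕ), ∀ t ∈ S, ∀ (x : X) (m : Fin n → X),
      iteratedFDeriv ℝ n (fun y => iteratedDeriv a (fun s => w s y) t) x m =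
        iteratedDeriv a (fun s => iteratedFDeriv ℝ n (w s) x m) t := by
  intro a
  induction a with
  | zero =>
    intro w h n t ht x m
    simp only [iteratedDeriv_zero]
  | succ a ih =>
    intro w h n t ht x m
    -- the time-derivative field
    set w₁ : ℝ → X → F := fun s y => deriv (fun σ => w σ y) s with hw₁
    have h₁ : IsSmoothSpaceTimeOn S w₁ := h.isSmoothSpaceTimeOn_deriv hS
    have e1 : (fun y => iteratedDeriv (a + 1) (fun s => w s y) t) = fun y => iteratedDeriv a (fun s => w₁ s y) t := by
      funext y
      rw [iteratedDeriv_succ']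
    rw [e1, ih h₁ n t ht x m, iteratedDeriv_succ']
    -- `deriv (s ↦ Dⁿ(w s)(x) m) = (s ↦ Dⁿ(w₁ s)(x) m)` near `t`
    refine iteratedDeriv_eq_of_eventuallyEq ?_ a
    filter_upwards [hS.mem_nhds ht] with s hs
    have hd := hasDerivAt_iteratedFDeriv_slice h hS n s hs x
    have hd' := ((ContinuousMultilinearMap.apply ℝ (fun _ : Fin n => X) F m).hasFDerivAt.comp_hasDerivAt s hd).deriv
    simp only [ContinuousMultilinearMap.apply_apply] at hd'
    rw [← hd']
    rfl

end Exchange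


/-! ### Iterated derivatives of the Laplacian, the gradient and the convective term -/

section Pointwise

variable {F : Type*} [NormedAddCommGroup F] [NormedSpace ℝ F]

/-- `‖Dⁿ(Dᵏf)(x)‖ = ‖Dⁿ⁺ᵏf(x)‖` (the curryings are isometries). [folklore] -/
theorem norm_iteratedFDeriv_iteratedFDeriv_eq {X : Type*} [NormedAddCommGroup X] [NormedSpace ℝ X]
    (f : X → F) (x : X) : ∀ (k n : ℕ),
    ‖iteratedFDeriv ℝ n (iteratedFDeriv ℝ k f) x‖ = ‖iteratedFDeriv ℝ (n + k) f x‖ := by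
  intro k
  induction k with
  | zero =>
    intro n
    rw [iteratedFDeriv_zero_eq_comp, LinearIsometryEquiv.norm_iteratedFDeriv_comp_left, add_zero]
  | succ k ih =>
    intro n
    rw [iteratedFDeriv_succ_eq_comp_left,
      (continuousMultilinearCurryLeftEquiv ℝ (fun _ : Fin (k + 1) => X) F).symm.norm_iteratedFDeriv_comp_left,
      norm_iteratedFDeriv_fderiv, ih (n + 1), show n + 1 + k = n + (k + 1) by ring]

/-- **`‖Dⁿ(Δf)(x)‖ ≤ 3 ‖Dⁿ⁺²f(x)‖` on `ℝ³`** (the Laplacian is the trace of the Hessian over the standard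
basis, `Δf = Σᵢ D²f(·)(eᵢ, eᵢ)`). [folklore] -/
theorem norm_iteratedFDeriv_laplacian_le_three_mul {f : EuclideanSpace ℝ (Fin 3) → F} {n : ℕ}
    (hf : ContDiff ℝ (n + 2 : ℕ) f) (x : EuclideanSpace ℝ (Fin 3)) :
    ‖iteratedFDeriv ℝ n (Δ f) x‖ ≤ 3 * ‖iteratedFDeriv ℝ (n + 2) f x‖ := by
  classical
  set b := EuclideanSpace.basisFun (Fin 3) ℝ with hb
  have hbi : ∀ i, ‖b i‖ = 1 := fun i => b.orthonormal.1 i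
  have hD2 : ContDiff ℝ n (iteratedFDeriv ℝ 2 f) := hf.iteratedFDeriv_right (by push_cast; exact le_rfl)
  set L : Fin 3 → ((EuclideanSpace ℝ (Fin 3)) [×2]→L[ℝ] F) →L[ℝ] F := fun i =>
    ContinuousMultilinearMap.apply ℝ (fun _ : Fin 2 => EuclideanSpace ℝ (Fin 3)) F ![b i, b i] with hL
  have hLn : ∀ i, ‖L i‖ ≤ 1 := by
    intro i
    refine ContinuousLinearMap.opNorm_le_bound _ zero_le_one fun M => ?_
    rw [hL, ContinuousMultilinearMap.apply_apply, one_mul]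
    calc ‖M ![b i, b i]‖ ≤ ‖M‖ * ∏ j, ‖(![b i, b i] : Fin 2 → _) j‖ := M.le_opNorm _
      _ = ‖M‖ := by simp [Fin.prod_univ_two, hbi]
  have e : Δ f = fun x => ∑ i, (L i ∘ iteratedFDeriv ℝ 2 f) x := by
    rw [InnerProductSpace.laplacian_eq_iteratedFDeriv_orthonormalBasis f b]
    funext y
    simp only [hL, Function.comp_apply, ContinuousMultilinearMap.apply_apply]
  rw [e, iteratedFDeriv_fun_sum_apply fun i _ => ((L i).contDiff.comp hD2).contDiffAt]
  calc ‖∑ i, iteratedFDeriv ℝ n (L i ∘ iteratedFDeriv ℝ 2 f) x‖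
      ≤ ∑ i, ‖iteratedFDeriv ℝ n (L i ∘ iteratedFDeriv ℝ 2 f) x‖ := norm_sum_le _ _
    _ ≤ ∑ _i : Fin 3, ‖iteratedFDeriv ℝ (n + 2) f x‖ := by
        refine Finset.sum_le_sum fun i _ => ?_
        calc ‖iteratedFDeriv ℝ n (L i ∘ iteratedFDeriv ℝ 2 f) x‖ ≤ ‖L i‖ * ‖iteratedFDeriv ℝ n (iteratedFDeriv ℝ 2 f) x‖ :=
              (L i).norm_iteratedFDeriv_comp_left hD2.contDiffAt le_rfl
          _ ≤ 1 * ‖iteratedFDeriv ℝ n (iteratedFDeriv ℝ 2 f) x‖ := by gcongr; exact hLn i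
          _ = ‖iteratedFDeriv ℝ (n + 2) f x‖ := by rw [one_mul, norm_iteratedFDeriv_iteratedFDeriv_eq]
    _ = 3 * ‖iteratedFDeriv ℝ (n + 2) f x‖ := by simp

/-- **`‖Dⁿ(∇f)(x)‖ = ‖Dⁿ⁺¹f(x)‖`** (the gradient is the Riesz image of the derivative, and the Riesz map is a
linear isometry). [folklore] -/
theorem norm_iteratedFDeriv_gradient (f : EuclideanSpace ℝ (Fin 3) → ℝ) (n : ℕ) (x : EuclideanSpace ℝ (Fin 3)) :
    ‖iteratedFDeriv ℝ n (gradient f) x‖ = ‖iteratedFDeriv ℝ (n + 1) f x‖ := by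
  have e : gradient f = (InnerProductSpace.toDual ℝ (EuclideanSpace ℝ (Fin 3))).symm ∘ fderiv ℝ f := rfl
  rw [e, LinearIsometryEquiv.norm_iteratedFDeriv_comp_left, norm_iteratedFDeriv_fderiv]

/-- **Leibniz bound for the convective term**:
`‖Dⁿ((v·∇)v)(x)‖ ≤ Σᵢ C(n,i) ‖Dⁱ⁺¹v(x)‖ ‖Dⁿ⁻ⁱv(x)‖`. [folklore] -/
theorem norm_iteratedFDeriv_convect_self_le {v : EuclideanSpace ℝ (Fin 3) → EuclideanSpace ℝ (Fin 3)}
    (hv : ContDiff ℝ ∞ v) (n : ℕ) (x : EuclideanSpace ℝ (Fin 3)) :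
    ‖iteratedFDeriv ℝ n (convect v v) x‖ ≤
      ∑ i ∈ Finset.range (n + 1), (n.choose i : ℝ) * ‖iteratedFDeriv ℝ (i + 1) v x‖ *
        ‖iteratedFDeriv ℝ (n - i) v x‖ := by
  have e : convect v v = fun y => (fderiv ℝ v y) (v y) := rfl
  have hDv : ContDiff ℝ ∞ (fderiv ℝ v) := hv.fderiv_right (m := ∞) le_rfl
  rw [e]
  refine (norm_iteratedFDeriv_clm_apply hDv hv x (by exact_mod_cast le_top)).trans (le_of_eq ?_)
  refine Finset.sum_congr rfl fun i _ => ?_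
  rw [norm_iteratedFDeriv_fderiv]

end Pointwise

/-! ### The differentiated momentum equation -/

section Momentum

variable {v : ℝ → (EuclideanSpace ℝ (Fin 3)) → (EuclideanSpace ℝ (Fin 3))}
  {q : ℝ → (EuclideanSpace ℝ (Fin 3)) → ℝ}

/-- **`Dⁿ∂ₜv = Dⁿ(Δv − ∇q − (v·∇)v)`, pointwise bound**: for a classical solution of Navier–Stokes
(`ν = 1`, `f = 0`) on the past,
`‖Dⁿ(∂ₜv(t,·))(x)‖ ≤ 3‖Dⁿ⁺²v‖ + ‖Dⁿ⁺¹q‖ + Σᵢ C(n,i) ‖Dⁱ⁺¹v‖ ‖Dⁿ⁻ⁱv‖` at `(t, x)`. [folklore] -/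
theorem norm_iteratedFDeriv_timeDeriv_le (hcl : IsClassicalNSSolutionOn (Iio 0) 1 0 v q) {t : ℝ}
    (ht : t < 0) (n : ℕ) (x : EuclideanSpace ℝ (Fin 3)) :
    ‖iteratedFDeriv ℝ n (timeDeriv v t) x‖ ≤
      3 * ‖iteratedFDeriv ℝ (n + 2) (v t) x‖ + ‖iteratedFDeriv ℝ (n + 1) (q t) x‖ +
        ∑ i ∈ Finset.range (n + 1), (n.choose i : ℝ) * ‖iteratedFDeriv ℝ (i + 1) (v t) x‖ *
          ‖iteratedFDeriv ℝ (n - i) (v t) x‖ := by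
  have hv : ContDiff ℝ ∞ (v t) := hcl.contDiff_velocity ht
  have hp : ContDiff ℝ ∞ (q t) := hcl.contDiff_pressure ht
  have hvn : ContDiff ℝ (n + 2 : ℕ) (v t) := contDiff_infty.1 hv (n + 2)
  have hΔ : ContDiff ℝ n (Δ (v t)) := contDiff_laplacian (n := n) (by exact_mod_cast hvn)
  have hg : ContDiff ℝ n (gradient (q t)) :=
    ((InnerProductSpace.toDual ℝ (EuclideanSpace ℝ (Fin 3))).symm.contDiff.comp
      (hp.fderiv_right (m := n) (by exact_mod_cast le_top)))
  have hc : ContDiff ℝ n (convect (v t) (v t)) :=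
    contDiff_convect_self (n := n) (hv.of_le (by exact_mod_cast le_top))
  rw [timeDeriv_eq_of_classical hcl ht]
  have e1 : (fun x => (Δ (v t)) x - gradient (q t) x - convect (v t) (v t) x) =
      (fun y => (Δ (v t)) y - gradient (q t) y) - convect (v t) (v t) := rfl
  have e2 : (fun y => (Δ (v t)) y - gradient (q t) y) = Δ (v t) - gradient (q t) := rfl
  have h12 : ContDiff ℝ n (fun y => (Δ (v t)) y - gradient (q t) y) := hΔ.sub hg
  rw [e1, iteratedFDeriv_sub_apply h12.contDiffAt hc.contDiffAt, e2,
    iteratedFDeriv_sub_apply hΔ.contDiffAt hg.contDiffAt]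
  calc ‖iteratedFDeriv ℝ n (Δ (v t)) x - iteratedFDeriv ℝ n (gradient (q t)) x -
        iteratedFDeriv ℝ n (convect (v t) (v t)) x‖
      ≤ ‖iteratedFDeriv ℝ n (Δ (v t)) x‖ + ‖iteratedFDeriv ℝ n (gradient (q t)) x‖ +
          ‖iteratedFDeriv ℝ n (convect (v t) (v t)) x‖ :=
        (norm_sub_le _ _).trans (add_le_add (norm_sub_le _ _) le_rfl)
    _ ≤ _ := by
        have h1 := norm_iteratedFDeriv_laplacian_le_three_mul hvn x
        have h2 := norm_iteratedFDeriv_gradient (q t) n x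
        have h3 := norm_iteratedFDeriv_convect_self_le hv n x
        linarith

/-- **Scale-invariant bound for `∂ₜDⁿv`** from the scale-invariant bounds on `Dᵏv` (`k ≤ n + 2`) and on
`Dⁿ⁺¹q`: `(‖x‖+√(−t))^{n+3} ‖Dⁿ(∂ₜv(t,·))(x)‖ ≤ 3K_{n+2} + K_q + Σᵢ C(n,i) K_{i+1} K_{n−i}`. [folklore] -/
theorem weight_pow_mul_norm_iteratedFDeriv_timeDeriv_le (hcl : IsClassicalNSSolutionOn (Iio 0) 1 0 v q)
    (n : ℕ) {K : ℕ → ℝ} {Kq : ℝ}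
    (hK : ∀ k ≤ n + 2, ∀ t < (0 : ℝ), ∀ x : EuclideanSpace ℝ (Fin 3),
      (‖x‖ + Real.sqrt (-t)) ^ (k + 1) * ‖iteratedFDeriv ℝ k (v t) x‖ ≤ K k)
    (hq : ∀ t < (0 : ℝ), ∀ x : EuclideanSpace ℝ (Fin 3),
      (‖x‖ + Real.sqrt (-t)) ^ (n + 3) * ‖iteratedFDeriv ℝ (n + 1) (q t) x‖ ≤ Kq)
    {t : ℝ} (ht : t < 0) (x : EuclideanSpace ℝ (Fin 3)) :
    (‖x‖ + Real.sqrt (-t)) ^ (n + 3) * ‖iteratedFDeriv ℝ n (timeDeriv v t) x‖ ≤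
      3 * K (n + 2) + Kq + ∑ i ∈ Finset.range (n + 1), (n.choose i : ℝ) * K (i + 1) * K (n - i) := by
  set R : ℝ := ‖x‖ + Real.sqrt (-t) with hR
  have hst : 0 < Real.sqrt (-t) := Real.sqrt_pos.2 (by linarith)
  have hR0 : 0 < R := by rw [hR]; positivity
  have hK0 : ∀ k ≤ n + 2, 0 ≤ K k := fun k hk => le_trans (by positivity) (hK k hk t ht x)
  have hprod : ∀ i ∈ Finset.range (n + 1),
      R ^ (n + 3) * ((n.choose i : ℝ) * ‖iteratedFDeriv ℝ (i + 1) (v t) x‖ * ‖iteratedFDeriv ℝ (n - i) (v t) x‖)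
        ≤ (n.choose i : ℝ) * K (i + 1) * K (n - i) := by
    intro i hi
    have hi' : i ≤ n := Nat.lt_succ_iff.1 (Finset.mem_range.1 hi)
    have ha := hK (i + 1) (by omega) t ht x
    have hb := hK (n - i) (by omega) t ht x
    have hpow : R ^ (n + 3) = R ^ (i + 1 + 1) * R ^ (n - i + 1) := by
      rw [← pow_add]; congr 1; omega
    calc R ^ (n + 3) * ((n.choose i : ℝ) * ‖iteratedFDeriv ℝ (i + 1) (v t) x‖ * ‖iteratedFDeriv ℝ (n - i) (v t) x‖)
        = (n.choose i : ℝ) * ((R ^ (i + 1 + 1) * ‖iteratedFDeriv ℝ (i + 1) (v t) x‖) *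
            (R ^ (n - i + 1) * ‖iteratedFDeriv ℝ (n - i) (v t) x‖)) := by rw [hpow]; ring
      _ ≤ (n.choose i : ℝ) * (K (i + 1) * K (n - i)) := by
          refine mul_le_mul_of_nonneg_left ?_ (Nat.cast_nonneg _)
          exact mul_le_mul ha hb (by positivity) (hK0 (i + 1) (by omega))
      _ = (n.choose i : ℝ) * K (i + 1) * K (n - i) := by ring
  calc R ^ (n + 3) * ‖iteratedFDeriv ℝ n (timeDeriv v t) x‖
      ≤ R ^ (n + 3) * (3 * ‖iteratedFDeriv ℝ (n + 2) (v t) x‖ + ‖iteratedFDeriv ℝ (n + 1) (q t) x‖ +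
          ∑ i ∈ Finset.range (n + 1), (n.choose i : ℝ) * ‖iteratedFDeriv ℝ (i + 1) (v t) x‖ *
            ‖iteratedFDeriv ℝ (n - i) (v t) x‖) :=
        mul_le_mul_of_nonneg_left (norm_iteratedFDeriv_timeDeriv_le hcl ht n x) (by positivity)
    _ = 3 * (R ^ (n + 2 + 1) * ‖iteratedFDeriv ℝ (n + 2) (v t) x‖) +
          R ^ (n + 3) * ‖iteratedFDeriv ℝ (n + 1) (q t) x‖ +
          ∑ i ∈ Finset.range (n + 1), R ^ (n + 3) * ((n.choose i : ℝ) * ‖iteratedFDeriv ℝ (i + 1) (v t) x‖ *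
            ‖iteratedFDeriv ℝ (n - i) (v t) x‖) := by
        rw [mul_add, mul_add, Finset.mul_sum]; ring
    _ ≤ 3 * K (n + 2) + Kq + ∑ i ∈ Finset.range (n + 1), (n.choose i : ℝ) * K (i + 1) * K (n - i) := by
        have h1 := hK (n + 2) le_rfl t ht x
        have h2 := hq t ht x
        have h3 := Finset.sum_le_sum hprod
        linarith

end Momentum


/-! ### Windows and time-derivative towers -/

section Windows

open Summit.NavierStokesRegularity.NavierStokesRegularity.Theorems.SymmetricScarExists.LogtimeBernoulli
  (exists_weight_pow_mul_norm_iteratedFDeriv_le)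

variable {v : ℝ → (EuclideanSpace ℝ (Fin 3)) → (EuclideanSpace ℝ (Fin 3))}
  {q : ℝ → (EuclideanSpace ℝ (Fin 3)) → ℝ}

/-- The window `(t₁, t₂) ⊆ (−∞, 0)` lies in the past. [folklore] -/
theorem Ioo_subset_Iio_of_le {t₁ t₂ : ℝ} (h : t₂ ≤ 0) : Ioo t₁ t₂ ⊆ Iio 0 := fun _ hs => lt_of_lt_of_le hs.2 h

/-- **Spatial decay of a classical Type-I solution on a window, order zero in time**: on
`W = (t₁, t₂) ⋐ (−∞, 0)` every spatial derivative obeys `‖Dᵏv(t,y)‖ ≤ C/(1+|y|)` (the scale-invariant bounds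
`(‖y‖+√(−t))^{k+1}‖Dᵏv‖ ≤ K` of the sibling file, and `√(−t) ≥ √(−t₂) > 0` on the window). [folklore] -/
theorem window_decay_velocity (hcl : IsClassicalNSSolutionOn (Iio 0) 1 0 v q) {C : ℝ} (hdec : HasTypeIDecay C v)
    {t₁ t₂ : ℝ} (h₂ : t₂ < 0) (k : ℕ) :
    ∃ A : ℝ, 0 ≤ A ∧ ∀ t ∈ Ioo t₁ t₂, ∀ y : EuclideanSpace ℝ (Fin 3),
      ‖iteratedFDeriv ℝ k (v t) y‖ ≤ A / (1 + ‖y‖) := by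
  obtain ⟨K, hK0, hK⟩ := exists_weight_pow_mul_norm_iteratedFDeriv_le k C
  set σ₂ : ℝ := Real.sqrt (-t₂) with hσ₂
  have hσ₂0 : 0 < σ₂ := Real.sqrt_pos.2 (by linarith)
  set μ : ℝ := min σ₂ 1 with hμ
  have hμ0 : 0 < μ := lt_min hσ₂0 one_pos
  refine ⟨K / μ ^ (k + 1), by positivity, fun t ht y => ?_⟩
  have ht0 : t < 0 := ht.2.trans h₂
  have hst : 0 < Real.sqrt (-t) := Real.sqrt_pos.2 (by linarith)
  have hσ : σ₂ ≤ Real.sqrt (-t) := Real.sqrt_le_sqrt (by linarith [ht.2])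
  set R : ℝ := ‖y‖ + Real.sqrt (-t) with hR
  have hR0 : 0 < R := by rw [hR]; positivity
  have hb := hK v q hcl hdec t ht0 y
  -- `μ (1 + ‖y‖) ≤ R`
  have hμR : μ * (1 + ‖y‖) ≤ R := by
    have h1 : μ ≤ 1 := min_le_right _ _
    have h2 : μ ≤ σ₂ := min_le_left _ _
    rw [hR]; nlinarith [norm_nonneg y]
  have hμRk : (μ * (1 + ‖y‖)) ^ (k + 1) ≤ R ^ (k + 1) := pow_le_pow_left₀ (by positivity) hμR _
  have h1 : μ ^ (k + 1) * (1 + ‖y‖) ^ (k + 1) * ‖iteratedFDeriv ℝ k (v t) y‖ ≤ K := by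
    rw [← mul_pow]
    exact (mul_le_mul_of_nonneg_right hμRk (norm_nonneg _)).trans hb
  have hy1 : (1 + ‖y‖) ≤ (1 + ‖y‖) ^ (k + 1) := le_self_pow₀ (by linarith [norm_nonneg y]) (by omega)
  rw [le_div_iff₀ (by positivity), le_div_iff₀ (by positivity)]
  calc ‖iteratedFDeriv ℝ k (v t) y‖ * (1 + ‖y‖) * μ ^ (k + 1)
      ≤ ‖iteratedFDeriv ℝ k (v t) y‖ * (1 + ‖y‖) ^ (k + 1) * μ ^ (k + 1) := by gcongr
    _ = μ ^ (k + 1) * (1 + ‖y‖) ^ (k + 1) * ‖iteratedFDeriv ℝ k (v t) y‖ := by ring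
    _ ≤ K := h1

/-- **The time-derivative tower is jointly smooth and closed under `∂ₜ`**: for a field jointly smooth on an open
time set, `u_b(t, y) = ∂ₜᵇ w(t, y)` is jointly smooth and `∂ₜu_b = u_{b+1}`. [folklore] -/
theorem tower_props {X : Type*} [NormedAddCommGroup X] [NormedSpace ℝ X] {F : Type*} [NormedAddCommGroup F]
    [NormedSpace ℝ F] {S : Set ℝ} {w : ℝ → X → F} (hw : IsSmoothSpaceTimeOn S w) (hS : IsOpen S) :
    (∀ b, IsSmoothSpaceTimeOn S fun t y => iteratedDeriv b (fun s => w s y) t) ∧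
    ∀ b, ∀ t ∈ S, ∀ y, HasDerivAt (fun s => iteratedDeriv b (fun s' => w s' y) s)
      (iteratedDeriv (b + 1) (fun s' => w s' y) t) t := by
  refine ⟨isSmoothSpaceTimeOn_iteratedDeriv hw hS, fun b t ht y => ?_⟩
  rw [iteratedDeriv_succ]
  exact (isSmoothSpaceTimeOn_iteratedDeriv hw hS b).hasDerivAt_timeLine hS ht y

end Windows

/-- **Registered sub-goal `stub_apexRegTimeDerivative` of `stub_apexRegularity`**: the third member of the
scale-invariant package from the first two — `(‖x‖+√(−t))^{n+3} ‖∂ₜDⁿv‖ ≤ 3K_{n+2} + K_q + Σᵢ C(n,i)K_{i+1}K_{n−i}` for a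
classical solution on the past (`deriv_iteratedFDeriv_slice` and `weight_pow_mul_norm_iteratedFDeriv_timeDeriv_le`).
[folklore] -/
theorem stub_apexRegTimeDerivative :
    ∀ (v : ℝ → EuclideanSpace ℝ (Fin 3) → EuclideanSpace ℝ (Fin 3)) (q : ℝ → EuclideanSpace ℝ (Fin 3) → ℝ)
      (n : ℕ) (K : ℕ → ℝ) (Kq : ℝ), IsClassicalNSSolutionOn (Iio (0 : ℝ)) 1 0 v q → (∀ k ≤ n + 2, ∀ t < (0
      : ℝ), ∀ x : EuclideanSpace ℝ (Fin 3), (‖x‖ + Real.sqrt (-t)) ^ (k + 1) * ‖iteratedFDeriv ℝ k (v t) x‖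
      ≤ K k) → (∀ t < (0 : ℝ), ∀ x : EuclideanSpace ℝ (Fin 3), (‖x‖ + Real.sqrt (-t)) ^ (n + 3) *
      ‖iteratedFDeriv ℝ (n + 1) (q t) x‖ ≤ Kq) → ∀ t < (0 : ℝ), ∀ x : EuclideanSpace ℝ (Fin 3), (‖x‖ +
      Real.sqrt (-t)) ^ (n + 3) * ‖deriv (fun s => iteratedFDeriv ℝ n (v s) x) t‖ ≤ 3 * K (n + 2) + Kq + ∑
      i ∈ Finset.range (n + 1), (n.choose i : ℝ) * K (i + 1) * K (n - i) := by
  intro v q n K Kq hcl hK hq t ht x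
  rw [deriv_iteratedFDeriv_slice hcl.smooth_velocity isOpen_Iio n ht x]
  exact weight_pow_mul_norm_iteratedFDeriv_timeDeriv_le hcl n hK hq ht x

end Summit.NavierStokesRegularity.NavierStokesRegularity.Theorems.RellichScarScarRigidity

end
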